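import Summits.BirchSwinnertonDyer.BirchSwinnertonDyer.Theorems.QuadraticBranchSignedControlPlusEtaNonsurjConjADoorUnit
import Summits.BirchSwinnertonDyer.Rank1Residual.Additive.QuadraticBranchEvenMissingPPart
import Summits.BirchSwinnertonDyer.Rank1Residual.Additive.QuadraticBranchPlusLFunctionExistence
import Summits.BirchSwinnertonDyer.Rank1Residual.Additive.QuadraticBranchPeriodRatioOfManinFact
import Summits.BirchSwinnertonDyer.BirchSwinnertonDyer.Theorems.QuadraticBranchSignedControlPlusMainConjectureBranchCMRung
import Summits.BirchSwinnertonDyer.BirchSwinnertonDyer.Theorems.QuadraticBranchSignedControlEtaTransportPlus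
import Summits.BirchSwinnertonDyer.BirchSwinnertonDyer.Theorems.SchneiderFreeAdditiveX3PoitouTateReciprocitySumHolds
import Summits.BirchSwinnertonDyer.Rank1Residual.Additive.QuadraticBranchEvenReadingsOfEta
import HarnessLib

/-!
# Route `QuadraticBranchSignedControl` (rung K8, cell `bsd-potss`), residual crux `PlusEtaMainConjectureNonsurj`
# (stmt-BirchSwinnertonDyer-19606): THE UNIT-ROW DOOR REACHES `BSD_p` — `ord_p #Ш(W) = ord_p #Ш_an(W)` (`MissingPPartAt W p`) on a rank-ZERO
# NON-onto UNIT row from the class-group datum of ONE `p`-torsion point, modulo published inputs (seat `bsd-potss-k8eta-c2` g22)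

WHY. The cell's target currency is `Typed.MissingPPartAt W p` (Miller's `BSD(W,p)` last clause: `#Ш_an(W)` is rational with the `p`-adic
valuation of `#Ш(W)`). The route's support `Gss2Assembly` (ctrl g3, `missingPPartAt_of_signedControlCruxes_of_periodRatio`) reaches it on a
rank-`0` Gss2 pair from the `F`-form (C1_η) at the good supersingular twin `V` through the EXACT even control (Poitou–Tate — a tree theorem
since `SchneiderFreeAdditiveX3.PoitouTateReduction.poitouTate_selmerStructure_duality_real_holds` —, (R1⁺) = k8q-c3's PROVED plus transport
`etaTransportPlus`, (R2⁺) = Kitajima–Otsuki) and the value identity. The `η`-form (C1⁺_η)(V) gives the `F`-form by the route's PROVED descent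
frame + Kobayashi Thm. 1.2 (`PlusMCBranchCMRung.plusMainConjectureAt_of_plusEtaMainConjectureAt`, k8eta-c1). The unit-row door of the
companion file (`EtaConjADoorUnit`, p715862) gives (C1⁺_η)(V) on a UNIT row from statement (A) of the partner `W` — i.e. from a class-group door
datum. Chaining: **`MissingPPartAt W p` on every rank-0 UNIT row with a class-group door PASS, modulo NAMED PUBLISHED facts only** (Kobayashi
Thm. 1.2 / 2.2 / 4.1 / 6.2–7.3, Kitajima–Otsuki Thm. 1.3, GZK, modularity, newforms, Mazur's `p ∤ c₀`) and the displayed per-row data (two GRH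
class numbers or an eigen datum, the PARI unit certificate, `r_an(W) = 0`, the twin `V`). Rank-one rows would need the route's OPEN crux
`PAdicGrossZagierBranch` (C-cc-1) and Kobayashi Thm. 7.4 — not done here.

WHAT. §1 `missingPPartAt_of_plusEtaMainConjectureAt_of_analyticRank_eq_zero` — per-row rank-0 assembly from the `η`-form (the rank-0 branch of
ctrl g3's pair theorem `missingPPartAt_of_signedControlCruxes_of_periodRatio` with its class-wide binders replaced by per-row inputs and the
period ratio by Mazur). §2 `missingPPartAt_of_conjA_of_isUnit` — from (A)(W,p) + the unit certificate. §3 the four class-group door compositions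
(L6 / L6⁻ / L2 / L4). The imports of the `η → F` seam (k8eta-c1 `PlusMCBranchCMRung`, k8q-c3 `etaTransportPlus`) carry the route file in their
cone (theses-cone lint: warning) — unavoidable, the seam IS the route's proved descent frame `etaDescentFrame_proof`.

SCOPE (numbers, not adjectives; k8eta-c2 census at `p = 5`, GRH): the 188 in-table partner rows are non-unit by construction; the rows reached
are the rank-0 unit members of the twist families with a door PASS — u5a:8, 13, 17, 61 (L6⁻), u5a:41 (L4, `T = 0`), c5a:37 (L4 TWIST), c5f:37
(L4 `T = 0`) at this writing (records in the sequel file) —: NON-CM curves, additive potentially supersingular at `5`, mod-`5` image `C_ns⁺(5)`,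
five of them in NO CM congruence class — outside the domain of every `BSD_p` theorem in the tree (`bsdp_allCurves_of_not_corner_of_not_cornerF`
excludes additive `p`).

HONEST FRAMING (cell `bsd-potss`; FULL-BSD rank ≤ 1 programme, HUMAN RULING D-0036/D-0074): TOOL THEOREMS ONLY — no definition, no named
fact minted, no `sorry`, axioms standard; CONDITIONAL on the displayed named facts (hypothesis position: `hGZK hmod hnf hM h12 hKO h22 h41 h6273`)
and per-row inputs (numerics are evidence, not facts). No stub of 19606 is proved by name; the crux and the route stay OPEN; nothing is booked;
`BSD(W,p)` is ASSERTED for no pair — what is proved is the implication «named published facts + displayed row data ⟹ MissingPPartAt W p».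
`--supports stmt-BirchSwinnertonDyer-19606`.

References: [Kobayashi2003] Thm. 1.2 (p. 2), Thm. 2.2 (p. 5), Thm. 3.2 (p. 7), §4 + Thm. 4.1 (p. 8), Thm. 6.2/6.3/7.3 (p. 13), Thm. 9.3 (p. 26);
[KitajimaOtsuki2018] Main Thm. 1.3; [Mazur1978] Cor. 4.1; [MilneADT2006] I Thm. 4.10; [Miller2011LMS] §1, Def. 1.1; [CoatesSujatha2005] §3 (A);
[GreenbergLNM1716] §3–§4.
-/

set_option autoImplicit false
set_option linter.dupNamespace false
noncomputable section

open scoped Classical MatrixGroups ModularForm nonZeroDivisors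

open CongruenceSubgroup NumberField IsDedekindDomain Field WeierstrassCurve
open Literature.NumberTheory.EllipticCurves Literature.NumberTheory.EllipticCurves.ModularForms
  Literature.NumberTheory.EllipticCurves.Rank1Residual Literature.NumberTheory.EllipticCurves.Rank1Residual.Typed
  Literature.NumberTheory.GaloisRepresentations Literature.NumberTheory.GaloisCohomology Literature.NumberTheory.NumberFields
  Literature.NumberTheory.EllipticCurves.GreenbergVatsal2000 ZpExtension
open Summit.BirchSwinnertonDyer.Rank1Residual Summit.BirchSwinnertonDyer.Rank1Residual.Additive
open Summit.BirchSwinnertonDyer.BirchSwinnertonDyer.Theorems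

namespace Summit.BirchSwinnertonDyer.BirchSwinnertonDyer.Theorems.EtaConjADoorUnitBSD

variable (W : WeierstrassCurve ℚ) [W.IsElliptic] [W.IsGloballyMinimal] (p : ℕ) [hp : Fact p.Prime]

/-! ## §1 Per-row rank-0 assembly from the `η`-form (C1⁺_η)(V) -/

/-- **`MissingPPartAt W p` on a rank-0 Gss2 pair from (C1⁺_η) at the twin**, per row. `W` globally minimal, `p ≥ 5`, `V` a globally minimal
model of `W^{(p*)}` (`C • W^{(p*)} = V`) good at `p` with `a_p(V) = 0`, `r_an(W) = 0`, and Kobayashi's even main conjecture at `η` for `(V,p)`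
in the cell's print currency (`QuadraticBranchPlusEtaMainConjectureAt V p`). Named facts (hypothesis position): GZK, modularity, newforms
(`exists_isNewformOf`), Mazur's `p ∤ c₀` (period ratio), Kobayashi Thm. 1.2 (`η`-form ⟹ `F`-form by the route's PROVED descent frame,
`PlusMCBranchCMRung.plusMainConjectureAt_of_plusEtaMainConjectureAt`), Kitajima–Otsuki Thm. 1.3 ((R2⁺), read on `W`'s strict plus duals as in
the route's `closes`); Poitou–Tate is the tree theorem `SchneiderFreeAdditiveX3.PoitouTateReduction.poitouTate_selmerStructure_duality_real_holds`,
(R1⁺) is k8q-c3's proved `etaTransportPlus`. Then ctrl g2/g3's exact even control + value identity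
(`EvenControlZero.missingPPartAt_rankZero_of_readings`). CONDITIONAL; nothing booked.
[cite: Kobayashi2003, Thm. 1.2 (p. 2), §4 (p. 8), Thm. 9.3 (p. 26)] [cite: KitajimaOtsuki2018, Main Thm. 1.3] [cite: Mazur1978, Cor. 4.1]
[cite: MilneADT2006, I Thm. 4.10] [cite: Miller2011LMS, §1 and Def. 1.1] -/
theorem missingPPartAt_of_plusEtaMainConjectureAt_of_analyticRank_eq_zero
    (hGZK : rank_eq_analyticRank_of_analyticRank_le_one) (hmod : hasEntireLFunction_rat)
    (hnf : exists_isNewformOf) (hM : mazur_not_dvd_maninConstant_of_odd)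
    (h12 : Kobayashi2003.thm12_signedSelmerDual_finite_torsion)
    (hKO : KitajimaOtsuki2018.mainThm13_etaSignedSelmerDual_noFiniteSubmodule)
    (hp5 : 5 ≤ p) (V : WeierstrassCurve ℚ) [V.IsElliptic] [V.IsGloballyMinimal] (C : VariableChange ℚ)
    (hCV : C • W.quadraticTwist ((-1) ^ (p / 2) * p) = V)
    (hgood : V.HasGoodReductionAtPrime p) (hap : V.frobeniusTrace p = 0)
    (hη : QuadraticBranchPlusEtaMainConjectureAt V p) (hr0 : W.analyticRank = 0) :
    MissingPPartAt W p := by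
  have hp2 : p ≠ 2 := by omega
  -- `η`-form ⟹ `F`-form (C1_η) at the twin (descent frame proved; Thm. 1.2 named)
  have h1 : QuadraticBranchPlusMainConjectureAt V p :=
    PlusMCBranchCMRung.plusMainConjectureAt_of_plusEtaMainConjectureAt h12 hp5 hgood hap hη
  -- (R1⁺) at `W`: k8q-c3's plus transport, PROVED
  have hR1 : EvenBranchPlusCharIdealOfPlusMCAt W p :=
    SignedTwist.evenBranchPlusCharIdealOfPlusMCAt_of_plusMCEta W p (etaTransportPlus p hp5)
  -- (R2⁺) at `W`: Kitajima–Otsuki Thm. 1.3 (sign `+`), repackaging the Literature-side datum as in the route's `closes`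
  have hR2 : EvenBranchPlusNoFiniteSubmoduleAt W p :=
    SignedTwist.evenBranchPlusNoFiniteSubmoduleAt_of_kitajimaOtsuki13PlusEta W p
      fun K₀ _ _ _ _ ηq hηK V' _ _ hp2' hgood' hap' κ γ hκ hγ hγK D hfin htor M hM' =>
        hKO p K₀ ηq hηK V' hp2' hgood' hap' κ γ hκ hγ hγK 1
          { X := D.X
            addCommGroup := D.addCommGroup
            module := D.module
            conj_mem := D.conj_mem
            toDual := D.toDual
            bijective := D.bijective
            toDual_T_smul := D.toDual_T_smul
            toDual_C_smul := D.toDual_C_smul }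
          hfin htor M hM'
  -- the newform, Mazur's `p`-integral period ratio, a branch function, `L(W,1) ≠ 0`
  haveI : NeZero (V.conductorNorm ℤ) := ⟨V.conductorNorm_pos_holds.ne'⟩
  obtain ⟨f, hf⟩ := hnf V
  obtain ⟨ϖ, hϖ, hrel⟩ := periodRatio_of_mazur p hM hp5 V f hf hgood hap
  obtain ⟨L, hL⟩ := exists_isQuadraticBranchPlusLFunction_of_isNewformOf hp2 hf hgood hap ϖ hϖ
  have hLW : W.entireLFunction 1 ≠ 0 := by
    rw [← W.leadingLCoeff_eq_of_analyticRank_eq_zero hr0]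
    exact W.leadingLCoeff_ne_zero_holds (hmod W)
  exact EvenControlZero.missingPPartAt_rankZero_of_readings W p
    (SchneiderFreeAdditiveX3.PoitouTateReduction.poitouTate_selmerStructure_duality_real_holds ℚ) hGZK hmod hR1 hR2
    V C hp5 hCV hgood hap h1 hf hrel hL hLW

/-! ## §2 From statement (A) of the partner and the unit certificate -/

/-- **`MissingPPartAt W p` — `ord_p #Ш(W) = ord_p #Ш_an(W)` — on a rank-0 UNIT row from statement (A) of the partner ALONE** (granted the
named published facts): `W` globally minimal, `p ≥ 5`, twin `V` (`C • W^{(p*)} = V`, good, `a_p = 0`), statement (A) of Coates–Sujatha for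
`(W,p)` (cell currency), «every `L_p⁺(V,η,T)` is a unit of `Λ`» (PARI `μ = λ = 0`), `r_an(W) = 0`. The unit-row door (p715862) then §1. Named
facts `hGZK hmod hnf hM h12 hKO h22 h41 h6273`; Poitou–Tate and the plus transport are tree theorems. CONDITIONAL; nothing booked.
[cite: Kobayashi2003, Thm. 1.2 (p. 2), Thm. 2.2 (p. 5), §4 and Thm. 4.1 (p. 8), Thm. 9.3 (p. 26)] [cite: CoatesSujatha2005, §3 statement (A)]
[cite: KitajimaOtsuki2018, Main Thm. 1.3] [cite: Miller2011LMS, Def. 1.1] -/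
theorem missingPPartAt_of_conjA_of_isUnit
    (hGZK : rank_eq_analyticRank_of_analyticRank_le_one) (hmod : hasEntireLFunction_rat)
    (hnf : exists_isNewformOf) (hM : mazur_not_dvd_maninConstant_of_odd)
    (h12 : Kobayashi2003.thm12_signedSelmerDual_finite_torsion)
    (hKO : KitajimaOtsuki2018.mainThm13_etaSignedSelmerDual_noFiniteSubmodule)
    (h22 : Kobayashi2003.thm22_etaSignedSelmerDual_finite_torsion)
    (h41 : Kobayashi2003.thm41_plusEtaCharIdeal_dvd)
    (h6273 : Kobayashi2003.thm62_63_73_etaColemanPoitouTate)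
    (hp5 : 5 ≤ p) (V : WeierstrassCurve ℚ) [V.IsElliptic] [V.IsGloballyMinimal] (C : VariableChange ℚ)
    (hCV : C • W.quadraticTwist ((-1) ^ (p / 2) * p) = V)
    (hgood : V.HasGoodReductionAtPrime p) (hap : V.frobeniusTrace p = 0)
    (hA : ∀ (κ : ZpExtension ℚ p), κ.IsCyclotomic →
      ∃ (γ : absoluteGaloisGroup ℚ) (D : W.FineSelmerDualData κ γ),
        Module.Finite ℤ_[p] (RestrictScalars ℤ_[p] (IwasawaAlgebra p) D.X))
    (hunit : ∀ {N : ℕ} [NeZero N] {f : CuspForm (Gamma0 N) 2}, IsNewformOf V f →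
      ∀ (ϖ : ℚ), (if Even (p / 2) then (ϖ : ℝ) * V.realPeriodRat = plusPeriod f
          else (ϖ : ℝ) * V.imaginaryPeriodRat = minusPeriod f) →
      ∀ (Lη : IwasawaAlgebra p), IsQuadraticBranchPlusLFunction f p ϖ Lη → IsUnit Lη)
    (hr0 : W.analyticRank = 0) :
    MissingPPartAt W p :=
  missingPPartAt_of_plusEtaMainConjectureAt_of_analyticRank_eq_zero W p hGZK hmod hnf hM h12 hKO hp5 V C hCV hgood hap
    (EtaConjADoorUnit.quadraticBranchPlusEtaMainConjectureAt_of_conjA_of_isUnit p W h22 h41 h6273 V C hCV hA hunit) hr0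

/-! ## §3 Through the class-group doors on the partner of a row of crux 19606 -/

/-- **`MissingPPartAt W p` on a rank-0 UNIT row from the RELATIVE class-number datum** (door L6⁻, `v_p h(ℚ(P)) ≤ v_p h(ℚ(x(P)))`; the shape
of the UNCONGRUENT unit rows u5a:8, 13, 17, 61 at `p = 5`) — the tower-not-onto clause of the crux enters the door ((c1) by Serre/Dickson).
Named facts `hGZK hmod hnf hM h12 hKO h22 h41 h6273`; displayed: the class-group datum, the unit certificate, `r_an(W) = 0`, the twin.
CONDITIONAL; nothing booked. [cite: Kobayashi2003, §4 (p. 8), Thm. 9.3 (p. 26)] [cite: CoatesSujatha2005, §3 (A) and Thm. 3.4]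
[cite: NeukirchANT1999, Ch. III §1 Prop. (1.6) (ii),(iv)] [cite: Miller2011LMS, Def. 1.1] -/
theorem missingPPartAt_of_relClassNumber_of_isUnit
    (hGZK : rank_eq_analyticRank_of_analyticRank_le_one) (hmod : hasEntireLFunction_rat)
    (hnf : exists_isNewformOf) (hM : mazur_not_dvd_maninConstant_of_odd)
    (h12 : Kobayashi2003.thm12_signedSelmerDual_finite_torsion)
    (hKO : KitajimaOtsuki2018.mainThm13_etaSignedSelmerDual_noFiniteSubmodule)
    (h22 : Kobayashi2003.thm22_etaSignedSelmerDual_finite_torsion)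
    (h41 : Kobayashi2003.thm41_plusEtaCharIdeal_dvd)
    (h6273 : Kobayashi2003.thm62_63_73_etaColemanPoitouTate)
    [NeZero p] (hp5 : 5 ≤ p) (V : WeierstrassCurve ℚ) [V.IsElliptic] [V.IsGloballyMinimal] (C : VariableChange ℚ)
    (hC : C • W.quadraticTwist ((-1) ^ (p / 2) * p) = V)
    (hgood : V.HasGoodReductionAtPrime p) (hap : V.frobeniusTrace p = 0)
    (hns : ¬ ∀ m : ℕ, V.HasSurjectiveModNGaloisRep (p ^ m : ℕ))
    (hP : haveI : NumberField (W.divisionField p) := NumberField.mk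
      ∃ P : geomTorsion W (p : ℤ), P ≠ 0 ∧ ∀ τ : absoluteGaloisGroup ℚ, τ • P = -P →
        ∀ K : IntermediateField ℚ (W.divisionField p),
          K = IntermediateField.fixedField
            ((MulAction.stabilizer (absoluteGaloisGroup ℚ) P).map (absRestrictNormalHom (W.divisionField p))) →
        ∀ σ : K ≃ₐ[ℚ] K,
          (∀ x : K, absRestrictNormalHom (W.divisionField p) τ (x : W.divisionField p) =
            ((σ x : K) : W.divisionField p)) →
          padicValNat p (NumberField.classNumber K) ≤
            padicValNat p (NumberField.classNumber (IntermediateField.fixedField (Subgroup.zpowers σ))))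
    (hunit : ∀ {N : ℕ} [NeZero N] {f : CuspForm (Gamma0 N) 2}, IsNewformOf V f →
      ∀ (ϖ : ℚ), (if Even (p / 2) then (ϖ : ℝ) * V.realPeriodRat = plusPeriod f
          else (ϖ : ℝ) * V.imaginaryPeriodRat = minusPeriod f) →
      ∀ (Lη : IwasawaAlgebra p), IsQuadraticBranchPlusLFunction f p ϖ Lη → IsUnit Lη)
    (hr0 : W.analyticRank = 0) :
    MissingPPartAt W p :=
  missingPPartAt_of_plusEtaMainConjectureAt_of_analyticRank_eq_zero W p hGZK hmod hnf hM h12 hKO hp5 V C hC hgood hap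
    (EtaConjADoorUnit.quadraticBranchPlusEtaMainConjectureAt_of_relClassNumber_of_isUnit p V W C h22 h41 h6273 hp5 hC
      hgood hap hns hP hunit) hr0

/-- **`MissingPPartAt W p` on a rank-0 UNIT row from ONE class number** (door L6, `p ∤ h(ℚ(P))`). Named facts
`hGZK hmod hnf hM h12 hKO h22 h41 h6273`. CONDITIONAL; nothing booked. [cite: Kobayashi2003, §4 (p. 8), Thm. 9.3 (p. 26)]
[cite: CoatesSujatha2005, §3 (A) and Thm. 3.4] [cite: Miller2011LMS, Def. 1.1] -/
theorem missingPPartAt_of_not_dvd_classNumber_of_isUnit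
    (hGZK : rank_eq_analyticRank_of_analyticRank_le_one) (hmod : hasEntireLFunction_rat)
    (hnf : exists_isNewformOf) (hM : mazur_not_dvd_maninConstant_of_odd)
    (h12 : Kobayashi2003.thm12_signedSelmerDual_finite_torsion)
    (hKO : KitajimaOtsuki2018.mainThm13_etaSignedSelmerDual_noFiniteSubmodule)
    (h22 : Kobayashi2003.thm22_etaSignedSelmerDual_finite_torsion)
    (h41 : Kobayashi2003.thm41_plusEtaCharIdeal_dvd)
    (h6273 : Kobayashi2003.thm62_63_73_etaColemanPoitouTate)
    [NeZero p] (hp5 : 5 ≤ p) (V : WeierstrassCurve ℚ) [V.IsElliptic] [V.IsGloballyMinimal] (C : VariableChange ℚ)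
    (hC : C • W.quadraticTwist ((-1) ^ (p / 2) * p) = V)
    (hgood : V.HasGoodReductionAtPrime p) (hap : V.frobeniusTrace p = 0)
    (hns : ¬ ∀ m : ℕ, V.HasSurjectiveModNGaloisRep (p ^ m : ℕ))
    (hP : haveI : NumberField (W.divisionField p) := NumberField.mk
      ∃ P : geomTorsion W (p : ℤ), P ≠ 0 ∧
        ¬ p ∣ NumberField.classNumber (IntermediateField.fixedField
          ((MulAction.stabilizer (absoluteGaloisGroup ℚ) P).map (absRestrictNormalHom (W.divisionField p)))))
    (hunit : ∀ {N : ℕ} [NeZero N] {f : CuspForm (Gamma0 N) 2}, IsNewformOf V f →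
      ∀ (ϖ : ℚ), (if Even (p / 2) then (ϖ : ℝ) * V.realPeriodRat = plusPeriod f
          else (ϖ : ℝ) * V.imaginaryPeriodRat = minusPeriod f) →
      ∀ (Lη : IwasawaAlgebra p), IsQuadraticBranchPlusLFunction f p ϖ Lη → IsUnit Lη)
    (hr0 : W.analyticRank = 0) :
    MissingPPartAt W p :=
  missingPPartAt_of_plusEtaMainConjectureAt_of_analyticRank_eq_zero W p hGZK hmod hnf hM h12 hKO hp5 V C hC hgood hap
    (EtaConjADoorUnit.quadraticBranchPlusEtaMainConjectureAt_of_not_dvd_classNumber_of_isUnit p V W C h22 h41 h6273 hp5 hC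
      hgood hap hns hP hunit) hr0

/-- **`MissingPPartAt W p` on a rank-0 UNIT row from the plain tautological eigen-test** (door L2). Named facts
`hGZK hmod hnf hM h12 hKO h22 h41 h6273`. CONDITIONAL; nothing booked. [cite: Kobayashi2003, §4 (p. 8), Thm. 9.3 (p. 26)]
[cite: CoatesSujatha2005, §3 (A) and Thm. 3.4] [cite: DeoRaySujatha2023, §3 Thm. 3.8 (c2) (arXiv:2202.09937 p. 9)] [cite: Miller2011LMS, Def. 1.1] -/
theorem missingPPartAt_of_eigenHom_of_isUnit
    (hGZK : rank_eq_analyticRank_of_analyticRank_le_one) (hmod : hasEntireLFunction_rat)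
    (hnf : exists_isNewformOf) (hM : mazur_not_dvd_maninConstant_of_odd)
    (h12 : Kobayashi2003.thm12_signedSelmerDual_finite_torsion)
    (hKO : KitajimaOtsuki2018.mainThm13_etaSignedSelmerDual_noFiniteSubmodule)
    (h22 : Kobayashi2003.thm22_etaSignedSelmerDual_finite_torsion)
    (h41 : Kobayashi2003.thm41_plusEtaCharIdeal_dvd)
    (h6273 : Kobayashi2003.thm62_63_73_etaColemanPoitouTate)
    [NeZero p] (hp5 : 5 ≤ p) (V : WeierstrassCurve ℚ) [V.IsElliptic] [V.IsGloballyMinimal] (C : VariableChange ℚ)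
    (hC : C • W.quadraticTwist ((-1) ^ (p / 2) * p) = V)
    (hgood : V.HasGoodReductionAtPrime p) (hap : V.frobeniusTrace p = 0)
    (hns : ¬ ∀ m : ℕ, V.HasSurjectiveModNGaloisRep (p ^ m : ℕ))
    (hP : haveI : NumberField (W.divisionField p) := NumberField.mk
      ∃ P : geomTorsion W (p : ℤ), P ≠ 0 ∧
        ∀ K : IntermediateField ℚ (W.divisionField p),
          K = IntermediateField.fixedField
            ((MulAction.stabilizer (absoluteGaloisGroup ℚ) P).map (absRestrictNormalHom (W.divisionField p))) →
        ∀ μ : Additive (ClassGroup (𝓞 K)) →+ ZMod p,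
          (∀ (τ : absoluteGaloisGroup ℚ) (σ : K ≃ₐ[ℚ] K) (a : ℕ),
              (∀ x : K, absRestrictNormalHom (W.divisionField p) τ (x : W.divisionField p) =
                ((σ x : K) : W.divisionField p)) → τ • P = a • P →
              ∀ (I J : (Ideal (𝓞 K))⁰),
                (J : Ideal (𝓞 K)) = (I : Ideal (𝓞 K)).map (AmbiguousClass.intAut σ : 𝓞 K →+* 𝓞 K) →
                μ (Additive.ofMul (ClassGroup.mk0 J)) = a • μ (Additive.ofMul (ClassGroup.mk0 I))) →
          μ = 0)
    (hunit : ∀ {N : ℕ} [NeZero N] {f : CuspForm (Gamma0 N) 2}, IsNewformOf V f →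
      ∀ (ϖ : ℚ), (if Even (p / 2) then (ϖ : ℝ) * V.realPeriodRat = plusPeriod f
          else (ϖ : ℝ) * V.imaginaryPeriodRat = minusPeriod f) →
      ∀ (Lη : IwasawaAlgebra p), IsQuadraticBranchPlusLFunction f p ϖ Lη → IsUnit Lη)
    (hr0 : W.analyticRank = 0) :
    MissingPPartAt W p :=
  missingPPartAt_of_plusEtaMainConjectureAt_of_analyticRank_eq_zero W p hGZK hmod hnf hM h12 hKO hp5 V C hC hgood hap
    (EtaConjADoorUnit.quadraticBranchPlusEtaMainConjectureAt_of_eigenHom_of_isUnit p V W C h22 h41 h6273 hp5 hC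
      hgood hap hns hP hunit) hr0

/-- **`MissingPPartAt W p` on a rank-0 UNIT row from the Hecke-refined eigen datum ALONE** (door L4, `hVH`-free; the shape of u5a:41,
c5a:37, c5f:37 at `p = 5`). Named facts `hGZK hmod hnf hM h12 hKO h22 h41 h6273`. CONDITIONAL; nothing booked.
[cite: Kobayashi2003, §4 (p. 8), Thm. 9.3 (p. 26)] [cite: CoatesSujatha2005, §3 (A) and Thm. 3.4]
[cite: DeoRaySujatha2023, §3 Thm. 3.8 (c2) and the definition of H′_L (arXiv:2202.09937 p. 9)] [cite: Miller2011LMS, Def. 1.1] -/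
theorem missingPPartAt_of_heckeEigenHom_of_isUnit
    (hGZK : rank_eq_analyticRank_of_analyticRank_le_one) (hmod : hasEntireLFunction_rat)
    (hnf : exists_isNewformOf) (hM : mazur_not_dvd_maninConstant_of_odd)
    (h12 : Kobayashi2003.thm12_signedSelmerDual_finite_torsion)
    (hKO : KitajimaOtsuki2018.mainThm13_etaSignedSelmerDual_noFiniteSubmodule)
    (h22 : Kobayashi2003.thm22_etaSignedSelmerDual_finite_torsion)
    (h41 : Kobayashi2003.thm41_plusEtaCharIdeal_dvd)
    (h6273 : Kobayashi2003.thm62_63_73_etaColemanPoitouTate)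
    [NeZero p] (hp5 : 5 ≤ p) (V : WeierstrassCurve ℚ) [V.IsElliptic] [V.IsGloballyMinimal] (C : VariableChange ℚ)
    (hC : C • W.quadraticTwist ((-1) ^ (p / 2) * p) = V)
    (hgood : V.HasGoodReductionAtPrime p) (hap : V.frobeniusTrace p = 0)
    (hns : ¬ ∀ m : ℕ, V.HasSurjectiveModNGaloisRep (p ^ m : ℕ))
    (hP : haveI : NumberField (W.divisionField p) := NumberField.mk
      ∃ P : geomTorsion W (p : ℤ), P ≠ 0 ∧
        ∀ K : IntermediateField ℚ (W.divisionField p),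
          K = IntermediateField.fixedField
            ((MulAction.stabilizer (absoluteGaloisGroup ℚ) P).map (absRestrictNormalHom (W.divisionField p))) →
        ∀ μ : Additive (ClassGroup (𝓞 K)) →+ ZMod p,
          (∀ (τ : absoluteGaloisGroup ℚ) (σ : K ≃ₐ[ℚ] K) (a : ℕ),
              (∀ x : K, absRestrictNormalHom (W.divisionField p) τ (x : W.divisionField p) =
                ((σ x : K) : W.divisionField p)) → τ • P = a • P →
              ∀ (I J : (Ideal (𝓞 K))⁰),
                (J : Ideal (𝓞 K)) = (I : Ideal (𝓞 K)).map (AmbiguousClass.intAut σ : 𝓞 K →+* 𝓞 K) →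
                μ (Additive.ofMul (ClassGroup.mk0 J)) = a • μ (Additive.ofMul (ClassGroup.mk0 I))) →
          (∀ (τ τ₁ : absoluteGaloisGroup ℚ) (a a₁ b : ℕ) (Q : geomTorsion W (p : ℤ)),
              τ • P = a • P + Q → τ₁ • P = a₁ • P → τ₁ • Q = b • Q → (a₁ : ZMod p) ≠ (b : ZMod p) →
              ∀ I : (Ideal (𝓞 K))⁰,
                μ (Additive.ofMul (classGroupNorm K (W.divisionField p) (ClassGroup.mulEquiv
                  (AmbiguousClass.intAut (absRestrictNormalHom (W.divisionField p) τ))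
                    (classGroupExtend K (W.divisionField p) (ClassGroup.mk0 I))))) =
                  (Nat.card ((W.divisionField p) ≃ₐ[K] (W.divisionField p)) * a) •
                    μ (Additive.ofMul (ClassGroup.mk0 I))) →
          μ = 0)
    (hunit : ∀ {N : ℕ} [NeZero N] {f : CuspForm (Gamma0 N) 2}, IsNewformOf V f →
      ∀ (ϖ : ℚ), (if Even (p / 2) then (ϖ : ℝ) * V.realPeriodRat = plusPeriod f
          else (ϖ : ℝ) * V.imaginaryPeriodRat = minusPeriod f) →
      ∀ (Lη : IwasawaAlgebra p), IsQuadraticBranchPlusLFunction f p ϖ Lη → IsUnit Lη)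
    (hr0 : W.analyticRank = 0) :
    MissingPPartAt W p :=
  missingPPartAt_of_plusEtaMainConjectureAt_of_analyticRank_eq_zero W p hGZK hmod hnf hM h12 hKO hp5 V C hC hgood hap
    (EtaConjADoorUnit.quadraticBranchPlusEtaMainConjectureAt_of_heckeEigenHom_of_isUnit p V W C h22 h41 h6273 hp5 hC
      hgood hap hns hP hunit) hr0

end Summit.BirchSwinnertonDyer.BirchSwinnertonDyer.Theorems.EtaConjADoorUnitBSD

end
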